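import Summits.RiemannHypothesis.RiemannHypothesis.Theorems.PfPersistenceEdgeLawCorner
import Summits.RiemannHypothesis.RiemannHypothesis.Theorems.PfPersistenceEdgeLawEdgeValue
import Summits.RiemannHypothesis.RiemannHypothesis.Theorems.PfPersistenceEdgeLawEntering
import HarnessLib

/-!
# The kink law of the window bottom at an entering prime power — RH-free helper

pub-rhpf (mechanism / rigidity campaign; **no RH claims**), theory-1 gen 5, THEORY-EDGE-5 §2.4.

Assembly of `PfPersistenceEdgeLawCorner` (schema-level corner from an entering lag, Dini form),
`PfPersistenceEdgeLawEdgeValue` (left lag-derivative of the increment at the diameter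
`= 2 Re g(a) conj g(−a)` from the edge values) and `PfPersistenceEdgeLawEntering` (the regular
part of the profile is differentiable under interior regularity; entering weight
`w_ent(a) = Σ_{log n = 2a} Λ(n) n^{-1/2}`):

**KINK LAW** (`kink_weilGroundEnergy`, PROVED modulo the two NAMED regularity inputs). Let `u` be a
Weil ground state of the window `a`, whose increment `t ↦ D_t(ũ)` is differentiable at the
interior prime-power lags `log n < 2a` (derivatives `d n`) and which agrees on `(-a, a)` with a
function `g` continuous on `[-a, a]` (edge values `g(±a)`).  Put
`V_r = V_sw(u) + Σ_{log n < 2a} Λ(n) n^{-1/2} log n · d n`.  Then every `s < −V_r/a` is eventually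
below the left slopes of `ε = weilGroundEnergy` at `a`, and every
`s > −V_r/a − 4 w_ent(a) Re(g(a) conj g(−a))` is eventually above the right slopes; one-sided
derivatives satisfy `ε'(a⁻) − ε'(a⁺) ≥ 4 w_ent(a) Re(g(a) conj g(−a))` (`kink_gap_weilGroundEnergy`),
and `w_ent(a) Re(g(a) conj g(−a)) > 0` forces a corner (`not_differentiableAt_weilGroundEnergy_of_edge`).
For a real even state with edge value `θ`, at `a = ½ log n₀`: gap `≥ 4 Λ(n₀) n₀^{-1/2} θ²` — the
campaign's Galerkin kink law (PF.md §14.2; DATA THEORY-2.md §3: 6.5e-3 vs 6.9e-3 at `N = 48`).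
What is universal: the shape (every windowed form of the type, `WindowForm.corner_gap`); what reads
the arithmetic: only the weight `w_ent(a)` and the location `a = ½ log n₀`.  No RH content.

References: T. Kato, *Perturbation Theory for Linear Operators* (1966) II §6.4, VII §6.5;
E. Bombieri, Rend. Mat. Acc. Lincei (9) 11 (2000) 183–233, §4.
-/

set_option linter.dupNamespace false

noncomputable section

open MeasureTheory Set Filter
open scoped Topology ComplexConjugate

namespace Summit.RiemannHypothesis.RiemannHypothesis.Theorems.PfPersistence

open Literature.NumberTheory.LFunctions
open Summit.RiemannHypothesis.RiemannHypothesis.Theorems.WeilWindowFlowWindowLipschitz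

/-- The **regular virial** at the window `a`: small-window virial plus the interior prime-lag
virial `Σ_{log n < 2a} Λ(n) n^{-1/2} log n · d n` (`d n` = the lag-derivative of `D_t(ũ)` at
`t = log n`). -/
def weilRegularVirial (a : ℝ) (u : ℝ → ℂ) (d : ℕ → ℝ) : ℝ :=
  weilSmallWindowVirial a u +
    ∑ n ∈ weilInteriorLagIndex a,
      (ArithmeticFunction.vonMangoldt n : ℝ) / Real.sqrt n * (Real.log n * d n)

/-- The left lag-derivative of `D_t(ũ)` at the diameter from the edge values of the state.
[folklore] -/
theorem hasDerivWithinAt_weilIncrement_weilTrunc_diam {a : ℝ} {u g : ℝ → ℂ}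
    (hu : IsWeilGroundState a u) (hg : ContinuousOn g (Icc (-a) a))
    (hug : ∀ x ∈ Ioo (-a) a, u x = g x) :
    HasDerivWithinAt (weilIncrement (weilTrunc a u)) (2 * (g a * conj (g (-a))).re)
      (Iio (2 * a)) (2 * a) :=
  hasDerivWithinAt_weilIncrement_diam hu.pos (isWeilGroundState_weilTrunc hu).memLp
    (fun x hx ↦ weilTrunc_eq_zero u hx)
    (fun x hx ↦ by rw [weilTrunc, Set.indicator_of_mem hx]; exact hug x hx) hg

/-- **THE KINK LAW (Dini form).** See the module docstring. [folklore: Kato VII §6.5 + PF §14.2] -/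
theorem kink_weilGroundEnergy {a : ℝ} {u g : ℝ → ℂ} (hu : IsWeilGroundState a u) {d : ℕ → ℝ}
    (hd : ∀ n ∈ weilInteriorLagIndex a,
      HasDerivAt (weilIncrement (weilTrunc a u)) (d n) (Real.log n))
    (hg : ContinuousOn g (Icc (-a) a)) (hug : ∀ x ∈ Ioo (-a) a, u x = g x) :
    (∀ s : ℝ, s < -weilRegularVirial a u d / a →
        ∀ᶠ b in 𝓝[<] a, s < slope weilGroundEnergy a b) ∧
      (∀ s : ℝ, -weilRegularVirial a u d / a -
          2 * weilEnteringWeight a * (2 * (g a * conj (g (-a))).re) < s →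
        ∀ᶠ b in 𝓝[>] a, slope weilGroundEnergy a b < s) :=
  corner_weilGroundEnergy_of_entering_lag hu (hasDerivAt_weilDilationProfile_sub_entering hu hd)
    (hasDerivWithinAt_weilIncrement_weilTrunc_diam hu hg hug)

/-- **THE KINK GAP.** One-sided derivatives `e₋` (from the left) and `e₊` (from the right) of
`weilGroundEnergy` at the window `a` satisfy `e₋ − e₊ ≥ 4 · w_ent(a) · Re(g(a) conj g(−a))`.
[folklore: Kato VII §6.5 + PF §14.2] -/
theorem kink_gap_weilGroundEnergy {a : ℝ} {u g : ℝ → ℂ} (hu : IsWeilGroundState a u) {d : ℕ → ℝ}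
    (hd : ∀ n ∈ weilInteriorLagIndex a,
      HasDerivAt (weilIncrement (weilTrunc a u)) (d n) (Real.log n))
    (hg : ContinuousOn g (Icc (-a) a)) (hug : ∀ x ∈ Ioo (-a) a, u x = g x) {em ep : ℝ}
    (hem : HasDerivWithinAt weilGroundEnergy em (Iio a) a)
    (hep : HasDerivWithinAt weilGroundEnergy ep (Ioi a) a) :
    4 * weilEnteringWeight a * (g a * conj (g (-a))).re ≤ em - ep := by
  have h := corner_gap_weilGroundEnergy hu (hasDerivAt_weilDilationProfile_sub_entering hu hd)
    (hasDerivWithinAt_weilIncrement_weilTrunc_diam hu hg hug) hem hep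
  linarith

/-- **Positive edge product at an entering prime power forces a corner of the bottom.**
[folklore: Kato VII §6.5 + PF §14.2] -/
theorem not_differentiableAt_weilGroundEnergy_of_edge {a : ℝ} {u g : ℝ → ℂ}
    (hu : IsWeilGroundState a u) {d : ℕ → ℝ}
    (hd : ∀ n ∈ weilInteriorLagIndex a,
      HasDerivAt (weilIncrement (weilTrunc a u)) (d n) (Real.log n))
    (hg : ContinuousOn g (Icc (-a) a)) (hug : ∀ x ∈ Ioo (-a) a, u x = g x)
    (hpos : 0 < weilEnteringWeight a * (g a * conj (g (-a))).re) :
    ¬ DifferentiableAt ℝ weilGroundEnergy a := by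
  intro hdiff
  have h := kink_gap_weilGroundEnergy hu hd hg hug hdiff.hasDerivAt.hasDerivWithinAt
    hdiff.hasDerivAt.hasDerivWithinAt
  linarith

/-- Where no prime power enters (`log n ≠ 2a` for all `2 ≤ n`) the kink term vanishes: the two
Dini bounds meet at `−V_r/a` (consistency with `dini_edge_law_weilGroundEnergy`). [folklore] -/
theorem kink_weilGroundEnergy_of_not_entering {a : ℝ} {u g : ℝ → ℂ} (hu : IsWeilGroundState a u)
    (hna : ∀ n : ℕ, 2 ≤ n → Real.log (n : ℝ) ≠ 2 * a) {d : ℕ → ℝ}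
    (hd : ∀ n ∈ weilInteriorLagIndex a,
      HasDerivAt (weilIncrement (weilTrunc a u)) (d n) (Real.log n))
    (hg : ContinuousOn g (Icc (-a) a)) (hug : ∀ x ∈ Ioo (-a) a, u x = g x) :
    (∀ s : ℝ, s < -weilRegularVirial a u d / a →
        ∀ᶠ b in 𝓝[<] a, s < slope weilGroundEnergy a b) ∧
      (∀ s : ℝ, -weilRegularVirial a u d / a < s →
        ∀ᶠ b in 𝓝[>] a, slope weilGroundEnergy a b < s) := by
  have h := kink_weilGroundEnergy hu hd hg hug
  rw [weilEnteringWeight_eq_zero hna] at h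
  simpa using h

end Summit.RiemannHypothesis.RiemannHypothesis.Theorems.PfPersistence

end
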